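import Mathlib
import Literature.NumberTheory.LFunctions.OddCharLogDerivFE
import Summits.HodgeConjecture.FermatCycles.HodgeFermatLemmaWFourier
import Summits.HodgeConjecture.FermatCycles.HodgeFermatHypUDefs

/-!
# HYPOTHESIS B reduced to two elementary residuals `HypH0` and `HypU` — part 1 (`HodgeFermat/HypBReduction.lean`; HF-G23)

Tree copy (part 1 of 2) of the module `HodgeFermat/HypBReduction.lean` of the sibling cell's standalone package
`run/shared/lean/pub/pub-hodgefermat/lean/HodgeFermat/` (456 lines, sha256 `6fcdd419c4c074d1…`), source lines 55–254 (§§1–4: `HypH0`, the value `L(χ, 0)`, the moment, primitive characters, a bad character has a bad prime).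
Filed by cell `pub-hfermat`, seat prover-1 gen-3, on the COORDINATOR KEEPER RULING of 2026-08-25 (gem sweep H1: take the
off-gate kernel theorem `thmFstar` through the gate) — here THEOREM F* of `tables/DPRIME-THEOREM.md` §9 IN FULL, i.e.
PROPOSITION D′(3N) and the descent (`HodgeFermat/PropDPrimeNFinal.lean`, GATE HF-G34), the last off-gate form of THEOREM F*
(its first two forms, `DecodingFinal.thmFstar` = F* at the prime levels and `ThmFstarNFinal.thmFstar` = F*(3N), landed on
2026-08-25 as `HodgeFermatThmFstar.lean` / `HodgeFermatThmFstarN.lean`, seats prover-1 gen-0 / gen-2); this file is one link of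
the import closure of `PropDPrimeNFinal.propDprime` (the sibling's KR-free chain: THEOREM L, COROLLARY M, THEOREM D6,
THEOREM U⁺, THEOREM KR6, THEOREM Z3U) on top of those landed chains.  The source module is the sibling's hub-checked module of
record (pub-hodgefermat `CERT.md` l.894, GATE HF-G23; cell record `check/HypBReduction_standalone.lean` sha256 `3048bda4e3749181…`); its declarations are copied VERBATIM.
Deviations from the source module, exhaustively: the `import` lines (tree modules `Summits.HodgeConjecture.FermatCycles.
HodgeFermat*` instead of `HodgeFermat.*`); this module docstring; DEDUP (pre-empting the gate's `dedup.landed`): the source's `lemma odd_inv` (l.132–136, with its `omit [NeZero N] in`) and `lemma ne_one_of_odd` (l.138–145, idem) restate the landed `Literature.NumberTheory.LFunctions.OddCharLogDeriv.odd_inv` / `….ne_one_of_odd` (`Literature/NumberTheory/LFunctions/OddCharLogDerivFE.lean`, [folklore]) VERBATIM up to the hypothesis name (dry-run 2026-08-25: `dedup.landed … ne_one_of_odd ≡ OddCharLogDeriv.ne_one_of_odd`); both are DELETED and re-bound by the added line `open Literature.NumberTheory.LFunctions.OddCharLogDeriv (odd_inv ne_one_of_odd)` after the source's `open` line (l.59;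 extra import), so the use sites (source l.150, 176, 180, 230) stay byte-identical; one-line docstrings added (gate lint) to `hurwitzZeta_toAddCircle_zero`, `sum_units_eq_sum`, `lfunction_zero_ne_zero`; the file ends at source l.254 with an `end` line (part 2 = the first module of `HodgeFermatD6OneFile.lean`).  (`tau`, `HypU`, `URange`, `UTail` of this namespace are the landed `HodgeFermatHypUDefs.lean`, imported as in the source.)
Every other line — in particular every declaration's statement and proof — is byte-identical to the source.
HONEST FRAMING: explicit algebraic cycles for specific Hodge classes on Fermat/Delsarte varieties; residual open instances
listed; no claim on general Hodge.  (This file is arithmetic of CM types / finite combinatorics / analytic number theory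
of the sibling's KR-free programme; it claims nothing about cycles.)

The source module's docstring (HypBReduction.lean l.7–53), verbatim:

## HYPOTHESIS B reduced to two elementary residuals — the analytic number theory in the kernel (HF-G23)

`HodgeFermat/LemmaWFourier.lean` (HF-G22d) proves THEOREM D6 from HYPOTHESIS B
(`HypB : ∀ N, 1 < N → Squarefree N → ¬ 2 ∣ N → ¬ 3 ∣ N → 12 * badCount N < N.totient`, where an odd Dirichlet
character `χ` mod `N` is BAD when its first moment `S(χ) = Σ_{v ∈ (ℤ/N)ˣ} χ(v⁻¹)·v` vanishes).  The by-hand proof of B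
had two halves: (i) `S(χ) ≠ 0` unless `χ̄_f(p) = 1` for some prime `p ∣ N` (Koblitz–Rohrlich lemma: `S(χ) = -N·L(0, χ̄)`,
`L(0, χ̄) = L(0, χ̄_f)·Π_{p ∣ N}(1 - χ̄_f(p))`, and `L(0, ψ) ≠ 0` for odd primitive `ψ` because `L(1, ψ̄) ≠ 0`), and
(ii) a count of the exceptional characters (LEMMA S).  THIS FILE puts (i) and the character-counting part of (ii) in
the kernel, using Mathlib's Dirichlet `L`-functions (`DirichletCharacter.LFunction`, Hurwitz-zeta definition,
`LFunction_changeLevel`, the functional equation `IsPrimitive.completedLFunction_one_sub`, non-vanishing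
`LFunction_apply_one_ne_zero`) and the duality theory of finite abelian groups (`MulChar.subgroupOrderIsoSubgroupMulChar`,
`DirichletCharacter.subgroupOfPrimitiveMapToOne`).  What remains are two ELEMENTARY residual hypotheses:

* `HypH0` — the classical special value `ζ(0, x) = 1/2 - x` (`0 < x < 1`) of the Hurwitz zeta function, for Mathlib's
  `HurwitzZeta.hurwitzZeta` (Mathlib v4.32.0 proves `hurwitzZeta_neg_nat` only for `k ≠ 0` and lists `s = 0` as a TODO:
  it needs a conditionally convergent Fourier series);
* `HypU` — the purely group-theoretic inequality `6 · Σ_{p ∣ N} τ(N, p) < φ(N)` for squarefree `N > 1` prime to `6`, where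
  `τ(N, p) = 0` if `-1 ∈ ⟨p⟩ ⊂ (ℤ/(N/p))ˣ` and `τ(N, p) = φ(N/p) / ord_{N/p}(p)` otherwise — dividing by `φ(N) = (p-1)·φ(N/p)`
  this is VERBATIM the inequality `U(N) := Σ_{p ∣ N} [-1 ∉ ⟨p⟩]/((p-1)·ord_{N/p}(p)) < 1/6` of LEMMA S (b)–(c) of
  `tables/SEMI-THEOREM.md` §2 (exact computation for the odd composite `N ≤ 10⁶` there, twice, and for the squarefree `N ≤ 10⁶`
  prime to `6` in this formulation by `code/gen23/hypU_check2.py` — maximum `6·U = 9/10` at `N = 55`; analytic tail from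
  `p^{ord} > N/p` for `N > 10⁶`, LEMMA S (b)).

Main results: `hypB_of_H0_U : HypH0 → HypU → HypB`, hence `thmU_of_H0_U : HypH0 → HypU → ThmU` and
`theoremD6_of_H0_U : HypH0 → HypU → D6`.

## Proof sketch (sections 1–6 below)

1. From `HypH0`: for an odd function `Φ` on `ℤ/N`, `ZMod.LFunction Φ 0 = -(Σ_j Φ(j)·j)/N` (`lfunction_zero_of_odd`;
   Mathlib's `LFunction Φ s = N^{-s} Σ_j Φ(j) ζ(s, j/N)` literally, `ZMod.toAddCircle_apply`, `Σ_j Φ(j) = 0`).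
2. `S(χ) = -N · L(χ⁻¹, 0)` (`charMoment_eq`).
3. `L(ψ, 0) ≠ 0` for `ψ` odd primitive (`lfunction_zero_ne_zero`): the functional equation for the primitive character
   `ψ⁻¹` at `s = 0` gives `Λ(ψ⁻¹, 1) = f^{-1/2}·ε(ψ⁻¹)·Λ(ψ, 0)`, and `Λ(ψ⁻¹, 1) = L(ψ⁻¹, 1)·Γ_ℝ(2) ≠ 0` by Dirichlet's
   theorem `L(ψ⁻¹, 1) ≠ 0`; `L(ψ, 0) = Λ(ψ, 0)/Γ_ℝ(1) = Λ(ψ, 0)`.  (No Gauss-sum non-vanishing is needed.)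
4. So a bad `χ` has `χ̄_f(p) = 1` for some prime `p ∣ N` (`LFunction_changeLevel` at `s = 0`: `L(χ⁻¹, 0) =
   L(χ̄_f, 0)·Π_p (1 - χ̄_f(p))`), i.e. `χ ∈ K_p := subgroupOfPrimitiveMapToOne ℂ N p` (`mem_K_of_bad`).
5. Counting by duality: `#Ann(u)·ord(u) = φ(M)` for a unit `u` mod `M` (`card_annihilator_mul_orderOf`), hence
   `#K_p · ord_{N'}(p) = φ(N')` with `N' = N/p^{v_p(N)}` (`card_K_mul_orderOf`); at most half of any subgroup of characters
   is odd (`two_mul_card_odd_le`, multiplication by a fixed odd member); and `K_p` has NO odd member when `-1` is a power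
   of `p` mod `N'` (`even_of_mem_K`).  Hence `2·#(K_p ∩ odd) ≤ τ(N, p)` at squarefree `N` (`two_mul_card_oddK_le`).
6. `#bad(N) ≤ Σ_{p ∣ N} #(K_p ∩ odd)`, so `12·#bad(N) ≤ 6·Σ_p τ(N, p) < φ(N)` by `HypU` (`hypB_of_H0_U`).

Hub check: `check/HypBReduction_standalone.lean` (this body appended to the fourteen bodies of
`check/LemmaWFourier_standalone.lean`), `lean check` rc 0, 0 sorries, `#print axioms theoremD6_of_H0_U` =
[propext, Classical.choice, Quot.sound] (`results/gen23/local/lean/`).  Inside the package: `lake build HodgeFermat.HypBReduction`.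
-/

/-! # The reduction of HYPOTHESIS B -/

namespace HodgeFermat.KRFree.HypBReduction

open Finset HodgeFermat.KRFree.LemmaWFourier HurwitzZeta DirichletCharacter
open Literature.NumberTheory.LFunctions.OddCharLogDeriv (odd_inv ne_one_of_odd)

/-! ## 0. The two residual hypotheses -/

/-- HYPOTHESIS H0 (classical special value, Hurwitz 1882): `ζ(0, x) = 1/2 - x` for `0 < x < 1`, stated for
Mathlib's `HurwitzZeta.hurwitzZeta` on `UnitAddCircle = ℝ/ℤ`.  (Mathlib v4.32.0 has `hurwitzZeta_neg_nat` only for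
`k ≠ 0`; the boundary value `s = 0` is a TODO there.) -/
def HypH0 : Prop :=
  ∀ x : ℝ, 0 < x → x < 1 → hurwitzZeta ((x : ℝ) : UnitAddCircle) 0 = 1 / 2 - (x : ℂ)

/- `tau` and `HypU` — generation-23 addendum (HF-G23d): the two definitions
  `noncomputable def tau (N p : ℕ) : ℕ := if ∃ k : ℕ, ((p : ℕ) : ZMod (N / p)) ^ k = -1 then 0
     else (N / p).totient / orderOf ((p : ℕ) : ZMod (N / p))`
  `def HypU : Prop := ∀ N, 1 < N → Squarefree N → ¬ 2 ∣ N → ¬ 3 ∣ N → 6 * ∑ p ∈ N.primeFactors, tau N p < N.totient`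
  now live VERBATIM, in this same namespace, in `HodgeFermat/HypUDefs.lean` (imported above), so that the kernel
  certificate files `HypUCert.lean` / `HypUFinite*.lean` can share them without importing the analytic chain. -/

/-! ## 1. The value `L(Φ, 0)` for odd `Φ` (from H0) -/

section value_at_zero

variable {N : ℕ} [NeZero N]

/-- `ζ(0, j/N) = 1/2 − j/N` on `AddCircle`, from `HypH0` -/
theorem hurwitzZeta_toAddCircle_zero (h0 : HypH0) {j : ZMod N} (hj : j ≠ 0) :
    hurwitzZeta (ZMod.toAddCircle j) 0 = 1 / 2 - ((j.val : ℕ) : ℂ) / N := by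
  rw [ZMod.toAddCircle_apply]
  have hN : (0 : ℝ) < N := Nat.cast_pos.mpr (NeZero.pos N)
  have hv : 0 < j.val := Nat.pos_of_ne_zero (fun h => hj ((ZMod.val_eq_zero j).mp h))
  have h1 : (0 : ℝ) < (j.val : ℝ) / N := div_pos (by exact_mod_cast hv) hN
  have h2 : (j.val : ℝ) / N < 1 := by
    rw [div_lt_one hN]
    exact_mod_cast ZMod.val_lt j
  rw [h0 _ h1 h2]
  push_cast
  ring

/-- `L(Φ, 0) = -(1/N) Σ_j Φ(j) · j` for an odd function `Φ` on `ℤ/N` (given H0). -/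
theorem lfunction_zero_of_odd (h0 : HypH0) {Φ : ZMod N → ℂ} (hΦ : Φ.Odd) :
    ZMod.LFunction Φ 0 = -(∑ j : ZMod N, Φ j * ((j.val : ℕ) : ℂ)) / N := by
  have hΦ0 : Φ 0 = 0 := hΦ.map_zero
  have hsum : ∑ j : ZMod N, Φ j = 0 := hΦ.sum_eq_zero
  have hterm : ∀ j : ZMod N, Φ j * hurwitzZeta (ZMod.toAddCircle j) 0
      = Φ j * (1 / 2) - Φ j * ((j.val : ℕ) : ℂ) / N := by
    intro j
    by_cases hj : j = 0
    · subst hj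
      simp [hΦ0]
    · rw [hurwitzZeta_toAddCircle_zero h0 hj]
      ring
  simp only [ZMod.LFunction, neg_zero, Complex.cpow_zero, one_mul]
  rw [Finset.sum_congr rfl (fun j _ => hterm j), Finset.sum_sub_distrib, ← Finset.sum_mul, hsum,
    zero_mul, zero_sub, ← Finset.sum_div, neg_div]

end value_at_zero

/-! ## 2. The first moment is `-N · L(χ⁻¹, 0)` -/

section moment

variable {N : ℕ} [NeZero N]

/-- a sum over the units equals the sum over `ZMod N` of a function vanishing off the units -/
lemma sum_units_eq_sum (g : ZMod N → ℂ) (hg : ∀ a, ¬ IsUnit a → g a = 0) :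
    ∑ v : (ZMod N)ˣ, g v = ∑ a : ZMod N, g a := by
  classical
  have hinj : ∀ x ∈ (Finset.univ : Finset (ZMod N)ˣ), ∀ y ∈ (Finset.univ : Finset (ZMod N)ˣ),
      (x : ZMod N) = y → x = y := fun x _ y _ h => Units.ext h
  rw [← Finset.sum_image hinj]
  apply Finset.sum_subset (Finset.subset_univ _)
  intro a _ ha
  apply hg
  rintro ⟨u, rfl⟩
  exact ha (Finset.mem_image_of_mem _ (Finset.mem_univ u))

/-- `S(χ) = -N · L(χ⁻¹, 0)` (given H0). -/
theorem charMoment_eq (h0 : HypH0) (χ : DirichletCharacter ℂ N) (hχ : χ.Odd) :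
    charMoment N χ = -(N : ℂ) * LFunction χ⁻¹ 0 := by
  have hodd' : Function.Odd (⇑(χ⁻¹ : DirichletCharacter ℂ N)) := (odd_inv hχ).to_fun
  have hL : LFunction χ⁻¹ 0 = -(∑ j : ZMod N, χ⁻¹ j * ((j.val : ℕ) : ℂ)) / N :=
    lfunction_zero_of_odd h0 hodd'
  have hS : ∑ j : ZMod N, χ⁻¹ j * ((j.val : ℕ) : ℂ) = charMoment N χ := by
    unfold charMoment
    rw [← sum_units_eq_sum (fun j => χ⁻¹ j * ((j.val : ℕ) : ℂ)) ?_]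
    · refine Finset.sum_congr rfl (fun v _ => ?_)
      rw [MulChar.inv_apply, Ring.inverse_unit]
    · intro a ha
      rw [MulChar.map_nonunit _ ha, zero_mul]
  rw [hL, hS]
  have hN : (N : ℂ) ≠ 0 := Nat.cast_ne_zero.mpr (NeZero.ne N)
  field_simp

end moment

/-! ## 3. `L(ψ, 0) ≠ 0` for odd primitive `ψ` (functional equation + `L(ψ⁻¹, 1) ≠ 0`) -/

section primitive

variable {f : ℕ} [NeZero f]

/-- `L(ψ, 0) ≠ 0` for an odd primitive character `ψ` -/
theorem lfunction_zero_ne_zero (ψ : DirichletCharacter ℂ f) (hprim : ψ.IsPrimitive) (hodd : ψ.Odd) :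
    LFunction ψ 0 ≠ 0 := by
  have hf1 : f ≠ 1 := by
    rintro rfl
    exact ne_one_of_odd hodd (DirichletCharacter.level_one ψ)
  have hprim' : (ψ⁻¹).IsPrimitive := by
    rw [DirichletCharacter.isPrimitive_def, DirichletCharacter.conductor_inv]
    exact hprim
  have hne : ψ⁻¹ ≠ 1 := inv_ne_one.mpr (ne_one_of_odd hodd)
  have hFE := DirichletCharacter.IsPrimitive.completedLFunction_one_sub hprim' 0
  rw [inv_inv, sub_zero] at hFE
  have hL1 : LFunction ψ⁻¹ 1 ≠ 0 := DirichletCharacter.LFunction_apply_one_ne_zero hne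
  have hΛ1 : completedLFunction ψ⁻¹ 1 ≠ 0 := by
    intro h
    apply hL1
    rw [DirichletCharacter.LFunction_eq_completed_div_gammaFactor ψ⁻¹ 1 (Or.inl one_ne_zero), h,
      zero_div]
  have hΛ0 : completedLFunction ψ 0 ≠ 0 := by
    intro h
    apply hΛ1
    rw [hFE, h, mul_zero]
  intro h
  apply hΛ0
  have h' := DirichletCharacter.LFunction_eq_completed_div_gammaFactor ψ 0 (Or.inr hf1)
  rw [hodd.gammaFactor_def, zero_add, Complex.Gammaℝ_one, div_one] at h'
  rw [← h', h]

end primitive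

/-! ## 4. Bad characters lie in the subgroups `K_p` -/

section badprime

variable {N : ℕ} [NeZero N]

/-- For a bad odd character `χ` mod `N`, the primitive character of `χ⁻¹` is `1` at some prime factor of `N`. -/
theorem exists_prime_of_bad (h0 : HypH0) {χ : DirichletCharacter ℂ N} (hχ : χ ∈ badSet N) :
    ∃ p ∈ N.primeFactors, (χ⁻¹).primitiveCharacter p = 1 := by
  classical
  have hodd : χ.Odd := (Finset.mem_filter.mp hχ).2.1
  have hmom : charMoment N χ = 0 := (Finset.mem_filter.mp hχ).2.2
  have hN : (N : ℂ) ≠ 0 := Nat.cast_ne_zero.mpr (NeZero.ne N)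
  have hL : LFunction χ⁻¹ 0 = 0 := by
    have h := charMoment_eq h0 χ hodd
    rw [hmom] at h
    rcases mul_eq_zero.mp h.symm with h1 | h1
    · exact absurd (neg_eq_zero.mp h1) hN
    · exact h1
  haveI : NeZero (χ⁻¹).conductor := ⟨DirichletCharacter.conductor_ne_zero χ⁻¹⟩
  have hlev := DirichletCharacter.LFunction_changeLevel (χ⁻¹).conductor_dvd_level
    (χ⁻¹).primitiveCharacter (s := 0) (Or.inr zero_ne_one)
  rw [DirichletCharacter.changeLevel_primitiveCharacter, hL] at hlev
  have hψodd : ((χ⁻¹).primitiveCharacter).Odd := by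
    have h1 := DirichletCharacter.primitiveCharacter_apply_of_isCoprime χ⁻¹ (a := -1)
      (isCoprime_one_left.neg_left)
    push_cast at h1
    show (χ⁻¹).primitiveCharacter (-1) = -1
    rw [h1]
    exact odd_inv hodd
  have hψ0 : LFunction (χ⁻¹).primitiveCharacter 0 ≠ 0 :=
    lfunction_zero_ne_zero _ (DirichletCharacter.primitiveCharacter_isPrimitive χ⁻¹) hψodd
  have hprod : ∏ p ∈ N.primeFactors,
      (1 - (χ⁻¹).primitiveCharacter p * (p : ℂ) ^ (-(0 : ℂ))) = 0 := by
    rcases mul_eq_zero.mp hlev.symm with h1 | h1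
    · exact absurd h1 hψ0
    · exact h1
  obtain ⟨p, hp, hp0⟩ := Finset.prod_eq_zero_iff.mp hprod
  refine ⟨p, hp, ?_⟩
  rw [neg_zero, Complex.cpow_zero, mul_one, sub_eq_zero] at hp0
  exact hp0.symm

/-- Hence a bad character lies in `K_p = subgroupOfPrimitiveMapToOne ℂ N p` for some prime `p ∣ N`. -/
theorem mem_K_of_bad (h0 : HypH0) {χ : DirichletCharacter ℂ N} (hχ : χ ∈ badSet N) :
    ∃ p ∈ N.primeFactors, ∀ hp : p.Prime,
      χ ∈ @subgroupOfPrimitiveMapToOne ℂ _ N _ p (Fact.mk hp) := by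
  obtain ⟨p, hp, hp1⟩ := exists_prime_of_bad h0 hχ
  refine ⟨p, hp, fun hpp => ?_⟩
  haveI := Fact.mk hpp
  rw [← Subgroup.inv_mem_iff]
  exact (DirichletCharacter.mem_subgroupOfPrimitiveMapToOne_iff χ⁻¹ p).mpr hp1

end badprime


end HodgeFermat.KRFree.HypBReduction
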